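import Literature.Probability.LatticeModels.LatticeLaplacianZd
import Mathlib.Order.ConditionallyCompleteLattice.Indexed
import Mathlib.Algebra.Order.Archimedean.Basic
import Mathlib.Algebra.BigOperators.Pi
import HarnessLib

/-!
# Stub `stub_liouville` of line `Sketch` (crux `stmt-QuantumFields-8760`)

Route `EquipartitionCriticality` of `YangMills`, crux item `stmt-QuantumFields-8760`
(`Summit.QuantumFields.YangMills.Theses.EquipartitionCriticality.EquipartitionPinsProbe`), line
`Sketch`, STUB L of the lead's skeleton.

What is proved: the **discrete Liouville theorem on `ℤ^d`** (every `d : ℕ`): a bounded function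
`u : Site d → ℝ` (`|u x| ≤ B`) which is harmonic for the graph Laplacian of `ℤ^d`
(`latticeLaplacianZd u x = 0` for all `x`) is constant. In the line it kills the harmonic
(constant-curvature) ambiguity of the tangent laws.

Proof (elementary, no compactness; namespace `Liouville`). Fix a direction `i` and put
`v x := u (x + eᵢ) − u x`, `eᵢ = Pi.single i 1`: `v` is bounded (`≤ 2B`) and harmonic
(`latticeLaplacianZd_sub`, `latticeLaplacianZd_comp_add`). Let `M := ⨆ v` (`le_ciSup`,
`exists_lt_of_lt_ciSup`). The mean-value property at a site `x` where `v ≤ M` everywhere gives the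
one-step loss estimate `M − v (x + eⱼ) ≤ 2d (M − v x)` (`Liouville.sub_le_mul_sub`: the `2d`
nonnegative defects `M − v (x ± eⱼ)` sum to `2d (M − v x)`), hence along a ray
`M − v (x + t eᵢ) ≤ (2d)^t (M − v x)` (`Liouville.sub_le_pow_mul_sub`). Telescoping,
`∑_{t<k} v (x + t eᵢ) = u (x + k eᵢ) − u x ≤ 2B`; choosing `x` with `v x > M − δ`,
`δ = 1 / (∑_{t<k} (2d)^t + 1)`, yields `k M ≤ 2B + 1` for every `k`, so `M ≤ 0` by the Archimedean
property (`Liouville.nonpos_of_sum_le`), i.e. `u (x + eᵢ) ≤ u x` everywhere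
(`Liouville.apply_add_single_le`). The same for `−u` gives `u (x + eᵢ) = u x`
(`Liouville.apply_add_single_eq`), then invariance under `x ↦ x + Pi.single i n`, `n : ℤ`
(`Int.induction_on`), and under every translate (`Pi.single_induction`). Only proved tree facts
(`LatticeLaplacianZd.lean`) and Mathlib are used.
-/

noncomputable section

open Literature.Probability.LatticeModels

namespace Summit.QuantumFields.YangMills.Theorems.EquipartitionPinsProbe

namespace Liouville

variable {d : ℕ}

/-- **One-step loss of near-maximality.** If `v ≤ M` on `ℤ^d` and `v` is harmonic, then at every
site `M − v (x + eᵢ) ≤ 2d · (M − v x)`: the `2d` nonnegative defects `M − v (x ± eⱼ)` add up to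
`2d M − ∑ⱼ (v (x + eⱼ) + v (x − eⱼ)) = 2d (M − v x)` by the mean-value property `Δ v (x) = 0`. -/
theorem sub_le_mul_sub {v : Site d → ℝ} {M : ℝ} (hle : ∀ x, v x ≤ M)
    (hv : ∀ x, latticeLaplacianZd v x = 0) (x : Site d) (i : Fin d) :
    M - v (x + Pi.single i 1) ≤ 2 * d * (M - v x) := by
  have hsum : ∑ j : Fin d, ((M - v (x + Pi.single j 1)) + (M - v (x - Pi.single j 1))) =
      2 * d * (M - v x) := by
    have h := hv x
    rw [latticeLaplacianZd_def] at h
    simp only [Finset.sum_add_distrib, Finset.sum_sub_distrib, Finset.sum_const, Finset.card_univ,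
      Fintype.card_fin, nsmul_eq_mul] at h ⊢
    linarith
  calc M - v (x + Pi.single i 1)
      ≤ (M - v (x + Pi.single i 1)) + (M - v (x - Pi.single i 1)) :=
        le_add_of_nonneg_right (sub_nonneg.2 (hle _))
    _ ≤ ∑ j : Fin d, ((M - v (x + Pi.single j 1)) + (M - v (x - Pi.single j 1))) :=
        Finset.single_le_sum (f := fun j : Fin d =>
            (M - v (x + Pi.single j 1)) + (M - v (x - Pi.single j 1)))
          (fun j _ => add_nonneg (sub_nonneg.2 (hle _)) (sub_nonneg.2 (hle _))) (Finset.mem_univ i)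
    _ = 2 * d * (M - v x) := hsum

/-- **Loss of near-maximality along a ray.** If `v ≤ M` on `ℤ^d` and `v` is harmonic, then
`M − v (x + t • eᵢ) ≤ (2d)^t · (M − v x)` for every `t : ℕ` (iterate `sub_le_mul_sub`). -/
theorem sub_le_pow_mul_sub {v : Site d → ℝ} {M : ℝ} (hle : ∀ x, v x ≤ M)
    (hv : ∀ x, latticeLaplacianZd v x = 0) (x : Site d) (i : Fin d) (t : ℕ) :
    M - v (x + t • (Pi.single i 1 : Site d)) ≤ (2 * d) ^ t * (M - v x) := by
  induction t with
  | zero => simp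
  | succ t ih =>
    rw [succ_nsmul, ← add_assoc, pow_succ]
    calc M - v (x + t • (Pi.single i 1 : Site d) + Pi.single i 1)
        ≤ 2 * d * (M - v (x + t • (Pi.single i 1 : Site d))) := sub_le_mul_sub hle hv _ i
      _ ≤ 2 * d * ((2 * d) ^ t * (M - v x)) := mul_le_mul_of_nonneg_left ih (by positivity)
      _ = (2 * d) ^ t * (2 * d) * (M - v x) := by ring

/-- **The supremum of a harmonic function with bounded ray sums is `≤ 0`.** Let `v ≤ M` be
harmonic on `ℤ^d` with `M` approached by values of `v` (`∀ δ > 0, ∃ y, M − δ < v y`), and suppose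
the partial sums of `v` along every ray in direction `eᵢ` are bounded above by `A`. Then `M ≤ 0`:
at a `δ`-maximiser `x₀`, `sub_le_pow_mul_sub` gives `∑_{t<k} v (x₀ + t eᵢ) ≥ k M − δ ∑_{t<k} (2d)^t`,
so `k M ≤ A + 1` for every `k` (take `δ = 1 / (∑_{t<k} (2d)^t + 1)`), and the Archimedean property
concludes. -/
theorem nonpos_of_sum_le {v : Site d → ℝ} {M A : ℝ} (hle : ∀ x, v x ≤ M)
    (hlt : ∀ δ : ℝ, 0 < δ → ∃ y, M - δ < v y) (hv : ∀ x, latticeLaplacianZd v x = 0) (i : Fin d)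
    (hA : ∀ (x : Site d) (k : ℕ), ∑ t ∈ Finset.range k, v (x + t • (Pi.single i 1 : Site d)) ≤ A) :
    M ≤ 0 := by
  have hkey : ∀ k : ℕ, (k : ℝ) * M ≤ A + 1 := by
    intro k
    obtain ⟨C, hC0, hC⟩ : ∃ C : ℝ, 0 ≤ C ∧ ∑ t ∈ Finset.range k, (2 * (d : ℝ)) ^ t = C :=
      ⟨_, Finset.sum_nonneg fun t _ => by positivity, rfl⟩
    have hC1 : 0 < C + 1 := by linarith
    obtain ⟨x₀, hx₀⟩ := hlt (1 / (C + 1)) (one_div_pos.2 hC1)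
    have hstep : ∀ t : ℕ, M - v (x₀ + t • (Pi.single i 1 : Site d)) ≤
        (2 * (d : ℝ)) ^ t * (1 / (C + 1)) := fun t =>
      (sub_le_pow_mul_sub hle hv x₀ i t).trans
        (mul_le_mul_of_nonneg_left (by linarith) (by positivity))
    have hsum : ∑ t ∈ Finset.range k, (M - v (x₀ + t • (Pi.single i 1 : Site d))) ≤
        ∑ t ∈ Finset.range k, (2 * (d : ℝ)) ^ t * (1 / (C + 1)) :=
      Finset.sum_le_sum fun t _ => hstep t
    rw [Finset.sum_sub_distrib, Finset.sum_const, Finset.card_range, nsmul_eq_mul,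
      ← Finset.sum_mul, hC] at hsum
    have hCle : C * (1 / (C + 1)) ≤ 1 := by
      rw [mul_one_div, div_le_one hC1]
      linarith
    linarith [hA x₀ k]
  by_contra hpos
  push Not at hpos
  obtain ⟨n, hn⟩ := exists_lt_nsmul hpos (A + 1)
  rw [nsmul_eq_mul] at hn
  linarith [hkey n]

/-- **One-sided Liouville.** A bounded harmonic function on `ℤ^d` is non-increasing along every
coordinate direction: `u (x + eᵢ) ≤ u x`. (Apply `nonpos_of_sum_le` to the bounded harmonic
forward difference `v := u (· + eᵢ) − u`, whose supremum `⨆ v` exists (`le_ciSup`,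
`exists_lt_of_lt_ciSup`) and whose ray sums telescope to `u (x + k eᵢ) − u x ≤ 2B`.) -/
theorem apply_add_single_le {u : Site d → ℝ} {B : ℝ} (hB : ∀ x, |u x| ≤ B)
    (hu : ∀ x, latticeLaplacianZd u x = 0) (x : Site d) (i : Fin d) :
    u (x + Pi.single i 1) ≤ u x := by
  -- the forward difference along `eᵢ`
  obtain ⟨v, hv⟩ : ∃ v : Site d → ℝ, v = (fun z => u (z + Pi.single i 1)) - u := ⟨_, rfl⟩
  have hv' : ∀ y, v y = u (y + Pi.single i 1) - u y := fun y => by rw [hv, Pi.sub_apply]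
  have h2B : ∀ y z, u y - u z ≤ 2 * B := fun y z => by
    have h1 := hB y
    have h2 := hB z
    have h3 := le_abs_self (u y)
    have h4 := neg_abs_le (u z)
    linarith
  have hbdd : BddAbove (Set.range v) :=
    ⟨2 * B, by rintro _ ⟨y, rfl⟩; rw [hv']; exact h2B _ _⟩
  obtain ⟨M, hle, hlt⟩ : ∃ M : ℝ, (∀ y, v y ≤ M) ∧ ∀ δ : ℝ, 0 < δ → ∃ y, M - δ < v y :=
    ⟨iSup v, fun y => le_ciSup hbdd y, fun δ hδ => exists_lt_of_lt_ciSup (sub_lt_self _ hδ)⟩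
  have hharm : ∀ y, latticeLaplacianZd v y = 0 := fun y => by
    rw [hv, latticeLaplacianZd_sub, latticeLaplacianZd_comp_add, hu, hu, sub_zero]
  have htel : ∀ (y : Site d) (k : ℕ), ∑ t ∈ Finset.range k, v (y + t • (Pi.single i 1 : Site d)) =
      u (y + k • (Pi.single i 1 : Site d)) - u y := by
    intro y k
    have h := Finset.sum_range_sub (fun t : ℕ => u (y + t • (Pi.single i 1 : Site d))) k
    simp only [succ_nsmul, ← add_assoc, zero_nsmul, add_zero] at h
    rw [← h]
    exact Finset.sum_congr rfl fun t _ => hv' _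
  have hM : M ≤ 0 :=
    nonpos_of_sum_le hle hlt hharm i (A := 2 * B) fun y k => by rw [htel]; exact h2B _ _
  have hx := hv' x
  linarith [hle x]

/-- **Unit-shift invariance.** A bounded harmonic function on `ℤ^d` satisfies `u (x + eᵢ) = u x`
(`apply_add_single_le` for `u` and for the bounded harmonic function `−u`). -/
theorem apply_add_single_eq {u : Site d → ℝ} {B : ℝ} (hB : ∀ x, |u x| ≤ B)
    (hu : ∀ x, latticeLaplacianZd u x = 0) (x : Site d) (i : Fin d) :
    u (x + Pi.single i 1) = u x := by
  refine le_antisymm (apply_add_single_le hB hu x i) ?_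
  have h := apply_add_single_le (u := -u) (B := B)
    (fun y => by rw [Pi.neg_apply, abs_neg]; exact hB y)
    (fun y => by rw [latticeLaplacianZd_neg, hu, neg_zero]) x i
  simp only [Pi.neg_apply, neg_le_neg_iff] at h
  exact h

/-- **Shift invariance along a coordinate axis.** A bounded harmonic function on `ℤ^d` satisfies
`u (x + Pi.single i n) = u x` for every `n : ℤ` (induction on `n` from `apply_add_single_eq`). -/
theorem apply_add_single_int_eq {u : Site d → ℝ} {B : ℝ} (hB : ∀ x, |u x| ≤ B)
    (hu : ∀ x, latticeLaplacianZd u x = 0) (i : Fin d) (n : ℤ) (x : Site d) :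
    u (x + Pi.single i n) = u x := by
  induction n generalizing x with
  | zero => rw [Pi.single_zero, add_zero]
  | succ n ih => rw [Pi.single_add, ← add_assoc, apply_add_single_eq hB hu, ih]
  | pred n ih =>
    have h := apply_add_single_eq hB hu (x + Pi.single i (-(n : ℤ) - 1)) i
    rw [add_assoc, ← Pi.single_add, sub_add_cancel] at h
    rw [← h, ih]

end Liouville

/-- STUB L — **Liouville on `ℤᵈ`**: a bounded harmonic function (`latticeLaplacianZd u = 0`) is
constant. Proof: by `Liouville.apply_add_single_int_eq`, `u` is invariant under every axis shift
`x ↦ x + Pi.single i n`; every translate is a sum of such (`Pi.single_induction`), so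
`u y = u (x + (y − x)) = u x`. -/
theorem stub_liouville :
    ∀ (d : ℕ) (u : Literature.Probability.LatticeModels.Site d → ℝ),
      (∃ B : ℝ, ∀ x, |u x| ≤ B) →
      (∀ x, Literature.Probability.LatticeModels.latticeLaplacianZd u x = 0) →
      ∀ x y, u x = u y := by
  intro d u hB hu x y
  obtain ⟨B, hB⟩ := hB
  have key : ∀ z w : Site d, u (w + z) = u w := by
    intro z
    induction z using Pi.single_induction with
    | zero => intro w; rw [add_zero]
    | add f g hf hg => intro w; rw [← add_assoc, hg, hf]
    | single i m => intro w; exact Liouville.apply_add_single_int_eq hB hu i m w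
  rw [← key (y - x) x, add_sub_cancel]

end Summit.QuantumFields.YangMills.Theorems.EquipartitionPinsProbe

end
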